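import Summits.QuantumFields.YangMills.Theorems.BalabanUVNodesN08AlphaEq324RowClassSocketEndInhabited
import Summits.QuantumFields.YangMills.Theorems.BalabanUVNodesN08AlphaEq324RowClassSocketEndCov
import Summits.QuantumFields.YangMills.Theorems.BalabanUVNodesN08AlphaEq324RowClassSocketEndCovUnitRange

/-!
# Route «BalabanUVNodes», Track-A DAG node N08 = [Balaban1985UV3] Thm 1 p. 257 ∕ Thm 2 p. 272 — THE COVARIANCE-CURRENCY SOCKET ENDS ARE INHABITED:
# the binder lists of seat n08-w5's `…ClassSocketEndCov` (η₀-route, p642023) and `…ClassSocketEndCovUnitRange` (η-route, p643485) are JOINTLY SATISFIABLE at every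
# lattice approximation, every record, every run step; the covariance rows force `g ≤ Λ_G`, `g ≤ K_G` (A6 certificate, covariance column)

Cell `pub-ymgap`, seat `pub-ymgap-dag-n08-w4` gen 6 (CLAIM-2 ∕ INTENT-2, INBOX l.40431).  `bears_on: R4∕N08`; filed `--supports stmt-QuantumFields-27364` (K1⁹, helper).  THEOREMS ONLY
(def-free, sorry-free, standard axioms); seat n08-w5's two END theorems and this seat's `…ClassSocketEndInhabited` (§1–§3: diagonal tests, the one-site member,
`one_le_sites`) consumed BY NAME.

WHY.  `…ClassSocketEndInhabited` (gen 6, part 1) certified the three PRECISION-currency ENDs.  Seat n08-w5's covariance-currency twins read the member through its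
COVARIANCE `Cv` (zero-extended to the kernel `K`; rows: `Λ ≠ ∅`, symmetric, `g`-coercive, `Λ_G`-bounded, `|Cv e e'| ≤ K_G e^{−κ_G|e−e'|₂}`) — the letter in which
[Balaban1985UV3] p. 261 speaks («a covariance having an exponential decay property») and in which N06's [B9] in-edges arrive.  Same question, same answer: the
one-site member `Cv₁ = g·1` on `{0}` (kernel `g·δ₀₀`) presenting the one-site datum `(ℝ^{ℤ^d}, 𝒩(0, g·δ₀₀), Πχ̂_{{0},p(g_k)}, H_{{0}})` by the identity discharges every
binder row of both ENDs, for all scalars with `g ≤ Λ_G`, `g ≤ K_G` — and §1 shows these two inequalities are forced by the rows on any nonempty window.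
* §1 `diag_le_of_upper` (`Cv e e ≤ Λ_G`); ★ `g_le_ΛG_of_member`, ★ `g_le_KG_of_member`.
* §2 `oneSite_upper` (the `Λ_G` row of `g·1` ⟸ `g ≤ Λ_G`), `oneSite_covKernel` (the zero-extended covariance `g·δ₀₀` in the ENDs' `hK` letter).
* §3 ★★ `eq324_oneSiteDatum_allSteps_cov` (p643485 FIRES: `∃ b₁ ∀ b₀ > b₁ ∃ C ≥ 0 ∀ S ∀ k ≤ K`, budget `C ≤ Ca + Cc` ⟹ (3.24) in [B10] currencies for the one-site datum,
  every `H_{{0}}` with `sup|coeff| ≤ c₀ g_k^σ`) · ★ `eq324_oneSiteDatum_cov_eta₀` (p642023 FIRES on `g_k ≤ η₀`).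
HONEST SCOPE.  Count-neutral A6 ∕ satisfiability bookkeeping about n08-w5's END theorems (their column; nothing of theirs restated or modified); the one-site datum is a
TOY, NOT [Balaban1985UV3]'s fluctuation block, NOT the IDENT (NODE 00 ∕ class II; NOT commissioned, NOT claimed); budget and windows displayed; nothing of
[Balaban1985UV3] ∕ [BenfattoEtAl1978] ∕ [Balaban1985BackgroundPropagators] asserted or discharged; `PrintedUV3V` NOT proved; N08 NOT discharged; one finite 𝕋⁴
programme at fixed ε — R4 closes the conditional finite-𝕋⁴ rung `BalabanLadder.UV` only; nothing continuum ∕ ℝ⁴ ∕ OS ∕ mass gap ∕ Clay.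
-/

noncomputable section

namespace Summit.QuantumFields.YangMills.Theorems.BalabanUVNodesN08AlphaEq324RowClassSocketEndCovInhabited

open MeasureTheory
open scoped BigOperators Nat
open Literature.MathematicalPhysics.QuantumFieldTheory (gaussianFieldOfKernel)
open Literature.MathematicalPhysics.QuantumFieldTheory.Balaban1983to89
open Literature.MathematicalPhysics.QuantumFieldTheory.Balaban1983to89.B1Sect3Statements (Eq324)
open Literature.MathematicalPhysics.QuantumFieldTheory.Balaban1983to89.B1Eq324BenfattoLemma (Coef hamiltonian coefSup smallFieldSet measurableSet_smallFieldSet)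
open Literature.MathematicalPhysics.QuantumFieldTheory.Balaban1983to89.B1Eq324BenfattoSect5Eq515 (measurable_hamiltonian)
open Literature.MathematicalPhysics.QuantumFieldTheory.Balaban1983to89.TreeLengthTorus (tsys)
open Literature.MathematicalPhysics.QuantumFieldTheory.Balaban1985CMP102.Setting
open Literature.MathematicalPhysics.QuantumFieldTheory.Balaban1985CMP102.Binders (GraphTerms)
open Summit.QuantumFields.Balaban3D.Carriers
open Summit.QuantumFields.Balaban3D.Proofs.Primitives (AlphaConsts)
open Summit.QuantumFields.Balaban3D.Proofs.GroupModelLieC (lieC)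
open Summit.QuantumFields.YangMills.Theorems.BalabanUVNodesN08AlphaEq324RowClassSocketEndInhabited
  (le_diag_of_coercive diag_le_of_decay oneSite_eq oneSite_sum oneSite_apply oneSite_symm oneSite_coercive oneSite_decay one_le_sites)
open Summit.QuantumFields.YangMills.Theorems.BalabanUVNodesN08AlphaEq324RowClassSocketEndCov (exists_h324Row_freeLetter_of_covDecayPresentation_ae)
open Summit.QuantumFields.YangMills.Theorems.BalabanUVNodesN08AlphaEq324RowClassSocketEndCovUnitRange
  (exists_threshold_h324Row_freeLetter_of_covDecayPresentation_allSteps_ae)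
open Literature.Probability.LatticeModels (cumulantOf)

variable {d : ℕ}

/-! ## §1 What the covariance rows FORCE on any nonempty window -/

section AnyMember

variable {Λ : Finset (Fin d → ℤ)} {Cv : Matrix ↥Λ ↥Λ ℝ} {g ΛG KG κG : ℝ}

/-- The upper form bound tested at a basis vector: `Cv e e ≤ Λ_G`. [folklore] -/
theorem diag_le_of_upper (hup : ∀ x : ↥Λ → ℝ, ∑ e, ∑ e', Cv e e' * x e * x e' ≤ ΛG * ∑ e, x e ^ 2) (e : ↥Λ) : Cv e e ≤ ΛG := by
  have h := le_diag_of_coercive (A := -Cv) (γA := -ΛG) (fun x => by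
    have := hup x
    simp only [Matrix.neg_apply, neg_mul, Finset.sum_neg_distrib]
    linarith) e
  simp only [Matrix.neg_apply] at h
  linarith

/-- ★ **The covariance rows of ANY member on a nonempty window force `g ≤ Λ_G`.** [folklore] -/
theorem g_le_ΛG_of_member (hΛ : Λ.Nonempty) (hco : ∀ x : ↥Λ → ℝ, g * ∑ e, x e ^ 2 ≤ ∑ e, ∑ e', Cv e e' * x e * x e')
    (hup : ∀ x : ↥Λ → ℝ, ∑ e, ∑ e', Cv e e' * x e * x e' ≤ ΛG * ∑ e, x e ^ 2) : g ≤ ΛG := by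
  obtain ⟨x, hx⟩ := hΛ
  exact (le_diag_of_coercive hco ⟨x, hx⟩).trans (diag_le_of_upper hup ⟨x, hx⟩)

/-- ★ **The covariance rows of ANY member on a nonempty window force `g ≤ K_G`.** [folklore] -/
theorem g_le_KG_of_member (hΛ : Λ.Nonempty) (hco : ∀ x : ↥Λ → ℝ, g * ∑ e, x e ^ 2 ≤ ∑ e, ∑ e', Cv e e' * x e * x e')
    (hdec : ∀ e e' : ↥Λ, |Cv e e'| ≤ KG * Real.exp (-(κG * Real.sqrt (∑ j, ((((e : Fin d → ℤ) j : ℝ) - ((e' : Fin d → ℤ) j : ℝ))) ^ 2)))) :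
    g ≤ KG := by
  obtain ⟨x, hx⟩ := hΛ
  exact (le_diag_of_coercive hco ⟨x, hx⟩).trans (diag_le_of_decay hdec ⟨x, hx⟩)

end AnyMember

/-! ## §2 The one-site covariance `Cv₁ = g·1` -/

section OneSite

variable (g : ℝ)

/-- Member row (covariance currency): the `Λ_G` row of `g·1` as soon as `g ≤ Λ_G`. [folklore] -/
theorem oneSite_upper {ΛG : ℝ} (hg : g ≤ ΛG) (x : ↥({0} : Finset (Fin d → ℤ)) → ℝ) :
    ∑ e, ∑ e', (g • (1 : Matrix ↥({0} : Finset (Fin d → ℤ)) ↥({0} : Finset (Fin d → ℤ)) ℝ)) e e' * x e * x e' ≤ ΛG * ∑ e, x e ^ 2 := by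
  set e₀ : ↥({0} : Finset (Fin d → ℤ)) := ⟨0, Finset.mem_singleton_self 0⟩
  rw [oneSite_sum d _ e₀, oneSite_sum d _ e₀, oneSite_sum d _ e₀, oneSite_apply]
  nlinarith [sq_nonneg (x e₀)]

/-- **The zero-extended one-site covariance is `g·δ₀₀`**, written in the Cov ENDs' `hK` letter (`K x y = if x, y ∈ Λ then Cv_{xy} else 0`). [folklore] -/
theorem oneSite_covKernel (x y : Fin d → ℤ) :
    (if x = 0 ∧ y = 0 then g else 0 : ℝ) =
      if hxy : x ∈ ({0} : Finset (Fin d → ℤ)) ∧ y ∈ ({0} : Finset (Fin d → ℤ)) then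
        (g • (1 : Matrix ↥({0} : Finset (Fin d → ℤ)) ↥({0} : Finset (Fin d → ℤ)) ℝ)) ⟨x, hxy.1⟩ ⟨y, hxy.2⟩ else 0 := by
  by_cases hxy : x ∈ ({0} : Finset (Fin d → ℤ)) ∧ y ∈ ({0} : Finset (Fin d → ℤ))
  · rw [dif_pos hxy, if_pos ⟨Finset.mem_singleton.1 hxy.1, Finset.mem_singleton.1 hxy.2⟩, oneSite_apply]
  · rw [dif_neg hxy, if_neg (fun h => hxy ⟨Finset.mem_singleton.2 h.1, Finset.mem_singleton.2 h.2⟩)]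

end OneSite

/-! ## §3 The two covariance-currency ENDs FIRE at the one-site datum -/

variable {L : ℕ} {G : Type} [GaugeGroup G] [MeasurableSpace G] [HaarData G] (𝔊 : GroupModel G) (𝔠 : AlphaConsts L 𝔊.N)

/-- ★★ **THE η-ROUTE COVARIANCE END (p643485) IS INHABITED.**  Class scalars `0 < g ≤ Λ_G`, `g ≤ K_G`, `κ_G > 0` (§1: both inequalities necessary), Hamiltonian shape
`(s, D, ϰ > 0)`, `p₀ > 2∕3`, `σ > 0`, `c₀ ≥ 0`, `6 + 2κ₀ < σ(n̄ + 1)`: `∃ b₁, ∀ b₀ > b₁, ∃ C ≥ 0` such that at EVERY `S`, EVERY run step `k ≤ K`, under the budget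
`C ≤ Ca + Cc`, for EVERY one-site potential `H_{{0}}` with `sup|coeff| ≤ c₀ g_k^σ`, the (3.24) row holds in [B10] currencies for the one-site datum with law `𝒩(0, g·δ₀₀)`.
PROOF = `exists_threshold_h324Row_freeLetter_of_covDecayPresentation_allSteps_ae` applied to the tower data whose every block is `(ℝ^{ℤ^d}, 𝒩(0, g·δ₀₀), Πχ̂_{{0},p(g_k)}, H_{{0}})`,
presented by `Φ := id` from the member `({0}, Cv₁ = g·1)`, `I = J = Λ = {0}`, `v := 1` — all binder rows discharged.
[cite: Balaban1985UV3, p.261 + (58) p.270; Balaban1982Higgs1, (3.24) p.616; BenfattoEtAl1978, Lemma p.152 (class form; ours)] -/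
theorem eq324_oneSiteDatum_allSteps_cov (hd : 0 < d) {g ΛG KG κG : ℝ} (hg0 : 0 < g) (hgΛ : g ≤ ΛG) (hgK : g ≤ KG) (hκG : 0 < κG)
    (s D : ℕ) {ϰ : ℝ} (hϰ : 0 < ϰ) {p₀ σ c₀ : ℝ} (hp₀ : 2 / 3 < p₀) (hσ : 0 < σ) (hc₀ : 0 ≤ c₀) (hκσ : 6 + 2 * 𝔠.κ₀ < σ * (𝔠.nbar + 1)) :
    ∃ b₁ : ℝ, ∀ b₀ : ℝ, b₁ < b₀ → ∃ C : ℝ, 0 ≤ C ∧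
      ∀ (S : Scales L) (k : ℕ), k ≤ S.K → C ≤ 𝔠.Ca + 𝔠.Cc →
        ∀ a : Coef d, coefSup s D a {0} ≤ c₀ * S.gk k ^ σ →
          Eq324 (∫ z in smallFieldSet ({0} : Finset (Fin d → ℤ)) (B10.pFun b₀ p₀ (S.gk k)), Real.exp (hamiltonian s D ϰ a {0} z)
                   ∂gaussianFieldOfKernel (fun x y : Fin d → ℤ => if x = 0 ∧ y = 0 then g else (0 : ℝ)))
            (fun n => cumulantOf (fun m => ∫ z, hamiltonian s D ϰ a {0} z ^ m
                   ∂gaussianFieldOfKernel (fun x y : Fin d → ℤ => if x = 0 ∧ y = 0 then g else (0 : ℝ))) n)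
            𝔠.nbar (𝔠.Ca + 𝔠.Cc) ((L : ℝ) ^ k * S.g0sq) (3 + 𝔠.κ₀) (S.sites k) := by
  obtain ⟨b₁, hb₁⟩ := exists_threshold_h324Row_freeLetter_of_covDecayPresentation_allSteps_ae 𝔊 𝔠 hd hg0 (hg0.trans_le hgΛ) (hg0.le.trans hgK)
    hκG D hϰ hp₀ hσ hc₀ hκσ
  refine ⟨b₁, fun b₀ hb => ?_⟩
  obtain ⟨C, hC, hEND⟩ := hb₁ b₀ hb
  refine ⟨C, hC, fun S k hk hCle a ha => ?_⟩
  -- the one-site datum: every block `(ℝ^{ℤ^d}, 𝒩(0, g·δ₀₀), Πχ̂_{{0}, p(g_k)}, H_{{0}})`, every other field of the carrier zero ∕ empty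
  let 𝔖₁ : ∀ k', StepSeries S G ↥(lieC 𝔊) (nblkOf S 𝔠.lane.carrier k') k' := fun k' =>
    { Ψ := fun _ _ => 0, Bcfg := fun _ _ _ => 0, far := fun _ _ _ => 0, PY := fun _ _ => 0, PYZ := fun _ _ => 0,
      Gt := fun _ => { Γ := PEmpty, supp := ∅, E := fun γ _ => γ.elim, loc := fun γ => γ.elim, nv := fun γ => γ.elim,
                       pref := fun γ => γ.elim, lines := fun γ => γ.elim },
      Ndeg := fun _ => 0, oldVal := fun _ _ _ _ _ _ => 0,
      Fl := (Fin d → ℤ) → ℝ, μ := gaussianFieldOfKernel (fun x y : Fin d → ℤ => if x = 0 ∧ y = 0 then g else (0 : ℝ)),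
      box := fun _ => smallFieldSet ({0} : Finset (Fin d → ℤ)) (B10.pFun b₀ p₀ (S.gk k)), 𝒱 := fun _ _ => hamiltonian s D ϰ a {0},
      dimZ := fun _ => 0, QU := fun _ _ => 0, JU := fun _ _ => 0, Q1 := fun _ => 0, J1 := fun _ => 0, dimT := 0, QT := 0, JT := 0 }
  exact hEND S 𝔖₁ k hk 1 (by rw [mul_one]; exact hCle)
    (fun _ _ => ({0} : Finset (Fin d → ℤ))) (fun _ _ => g • (1 : Matrix ↥({0} : Finset (Fin d → ℤ)) ↥({0} : Finset (Fin d → ℤ)) ℝ))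
    (fun _ _ x y => if x = 0 ∧ y = 0 then g else (0 : ℝ)) (fun _ _ => id) s
    (fun _ _ => ({0} : Finset (Fin d → ℤ))) (fun _ _ => ({0} : Finset (Fin d → ℤ))) (fun _ _ => a)
    (fun _ _ x y => oneSite_covKernel g x y) (fun _ _ => Finset.singleton_nonempty 0) (fun _ _ => oneSite_symm g)
    (fun _ _ => oneSite_coercive g) (fun _ _ => oneSite_upper g hgΛ) (fun _ _ => oneSite_decay g (by rwa [abs_of_pos hg0]) κG)
    (fun _ _ => measurable_id) (fun _ _ => Measure.map_id.symm) (fun _ => measurableSet_smallFieldSet _ _)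
    (fun _ _ => measurable_hamiltonian _) (fun _ _ => Filter.EventuallyEq.rfl) (fun _ _ => Filter.EventuallyEq.rfl)
    (fun _ _ => Finset.singleton_nonempty 0) (fun _ _ => subset_rfl) (fun _ _ => subset_rfl) (fun _ _ => ha)
    (fun _ _ => by rw [Finset.card_singleton, Nat.cast_one, one_mul]; exact one_le_sites S k hk)
    (fun _ => ∅) (fun _ => 1)

/-- ★ **THE η₀-ROUTE COVARIANCE END (p642023) IS INHABITED** on its own range `g_k ≤ η₀`: class scalars `0 < g ≤ Λ_G`, `g ≤ K_G`, `κ_G > 0`, Hamiltonian shape `(s, D, ϰ > 0)`,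
`b₀ > 0`, `p₀ > 2∕3`, `σ > 0`, `c₀ ≥ 0`, `6 + 2κ₀ < σ(n̄ + 1)`: `∃ η₀ ∈ (0, 1], ∃ C ≥ 0` such that at EVERY `S`, EVERY run step `k ≤ K` with `g_k ≤ η₀`, under `C ≤ Ca + Cc`, for
EVERY `H_{{0}}` with `sup|coeff| ≤ c₀ g_k^σ`, the (3.24) row holds in [B10] currencies for the one-site datum with law `𝒩(0, g·δ₀₀)` (same member ∕ instance as above).
[cite: Balaban1985UV3, p.261 + (58) p.270; Balaban1982Higgs1, (3.24) p.616; BenfattoEtAl1978, Lemma p.152 (class form; ours)] -/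
theorem eq324_oneSiteDatum_cov_eta₀ (hd : 0 < d) {g ΛG KG κG : ℝ} (hg0 : 0 < g) (hgΛ : g ≤ ΛG) (hgK : g ≤ KG) (hκG : 0 < κG)
    (s D : ℕ) {ϰ : ℝ} (hϰ : 0 < ϰ) {b₀ p₀ σ c₀ : ℝ} (hb₀ : 0 < b₀) (hp₀ : 2 / 3 < p₀) (hσ : 0 < σ) (hc₀ : 0 ≤ c₀)
    (hκσ : 6 + 2 * 𝔠.κ₀ < σ * (𝔠.nbar + 1)) :
    ∃ η₀ C : ℝ, 0 < η₀ ∧ η₀ ≤ 1 ∧ 0 ≤ C ∧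
      ∀ (S : Scales L) (k : ℕ), k ≤ S.K → S.gk k ≤ η₀ → C ≤ 𝔠.Ca + 𝔠.Cc →
        ∀ a : Coef d, coefSup s D a {0} ≤ c₀ * S.gk k ^ σ →
          Eq324 (∫ z in smallFieldSet ({0} : Finset (Fin d → ℤ)) (B10.pFun b₀ p₀ (S.gk k)), Real.exp (hamiltonian s D ϰ a {0} z)
                   ∂gaussianFieldOfKernel (fun x y : Fin d → ℤ => if x = 0 ∧ y = 0 then g else (0 : ℝ)))
            (fun n => cumulantOf (fun m => ∫ z, hamiltonian s D ϰ a {0} z ^ m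
                   ∂gaussianFieldOfKernel (fun x y : Fin d → ℤ => if x = 0 ∧ y = 0 then g else (0 : ℝ))) n)
            𝔠.nbar (𝔠.Ca + 𝔠.Cc) ((L : ℝ) ^ k * S.g0sq) (3 + 𝔠.κ₀) (S.sites k) := by
  obtain ⟨η₀, C, hη₀, hη₀1, hC, hEND⟩ := exists_h324Row_freeLetter_of_covDecayPresentation_ae 𝔊 𝔠 hd hg0 (hg0.trans_le hgΛ) (hg0.le.trans hgK)
    hκG D hϰ hb₀ hp₀ hσ hc₀ hκσ
  refine ⟨η₀, C, hη₀, hη₀1, hC, fun S k hk hgk hCle a ha => ?_⟩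
  let 𝔖₁ : ∀ k', StepSeries S G ↥(lieC 𝔊) (nblkOf S 𝔠.lane.carrier k') k' := fun k' =>
    { Ψ := fun _ _ => 0, Bcfg := fun _ _ _ => 0, far := fun _ _ _ => 0, PY := fun _ _ => 0, PYZ := fun _ _ => 0,
      Gt := fun _ => { Γ := PEmpty, supp := ∅, E := fun γ _ => γ.elim, loc := fun γ => γ.elim, nv := fun γ => γ.elim,
                       pref := fun γ => γ.elim, lines := fun γ => γ.elim },
      Ndeg := fun _ => 0, oldVal := fun _ _ _ _ _ _ => 0,
      Fl := (Fin d → ℤ) → ℝ, μ := gaussianFieldOfKernel (fun x y : Fin d → ℤ => if x = 0 ∧ y = 0 then g else (0 : ℝ)),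
      box := fun _ => smallFieldSet ({0} : Finset (Fin d → ℤ)) (B10.pFun b₀ p₀ (S.gk k)), 𝒱 := fun _ _ => hamiltonian s D ϰ a {0},
      dimZ := fun _ => 0, QU := fun _ _ => 0, JU := fun _ _ => 0, Q1 := fun _ => 0, J1 := fun _ => 0, dimT := 0, QT := 0, JT := 0 }
  exact hEND S 𝔖₁ k 1 hgk (by rw [mul_one]; exact hCle)
    (fun _ _ => ({0} : Finset (Fin d → ℤ))) (fun _ _ => g • (1 : Matrix ↥({0} : Finset (Fin d → ℤ)) ↥({0} : Finset (Fin d → ℤ)) ℝ))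
    (fun _ _ x y => if x = 0 ∧ y = 0 then g else (0 : ℝ)) (fun _ _ => id) s
    (fun _ _ => ({0} : Finset (Fin d → ℤ))) (fun _ _ => ({0} : Finset (Fin d → ℤ))) (fun _ _ => a)
    (fun _ _ x y => oneSite_covKernel g x y) (fun _ _ => Finset.singleton_nonempty 0) (fun _ _ => oneSite_symm g)
    (fun _ _ => oneSite_coercive g) (fun _ _ => oneSite_upper g hgΛ) (fun _ _ => oneSite_decay g (by rwa [abs_of_pos hg0]) κG)
    (fun _ _ => measurable_id) (fun _ _ => Measure.map_id.symm) (fun _ => measurableSet_smallFieldSet _ _)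
    (fun _ _ => measurable_hamiltonian _) (fun _ _ => Filter.EventuallyEq.rfl) (fun _ _ => Filter.EventuallyEq.rfl)
    (fun _ _ => Finset.singleton_nonempty 0) (fun _ _ => subset_rfl) (fun _ _ => subset_rfl) (fun _ _ => ha)
    (fun _ _ => by rw [Finset.card_singleton, Nat.cast_one, one_mul]; exact one_le_sites S k hk)
    (fun _ => ∅) (fun _ => 1)

end Summit.QuantumFields.YangMills.Theorems.BalabanUVNodesN08AlphaEq324RowClassSocketEndCovInhabited

end
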